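import Summits.BirchSwinnertonDyer.BirchSwinnertonDyer.Theses.SemiOrdinaryEisensteinDescent
import Summits.BirchSwinnertonDyer.BirchSwinnertonDyer.Theorems.SchneiderFreeAdditiveX3JointUpperManin
import Summits.BirchSwinnertonDyer.BirchSwinnertonDyer.Theorems.WildThreeRankOneBSDpOfExactIndexManin
import HarnessLib

/-!
# Route `SemiOrdinaryEisensteinDescent`, crux Ko `WildKolyvaginUpperAtThree` (stmt-BirchSwinnertonDyer-20480): Ko is TIGHT —
# it follows from the leaf it serves (`WAllExclAddWildRankOneSurj`) plus the route's declared rank-zero residual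
# (`WAllExclAddWildRankZero` = `WildRankZeroTwistAtThree`, stmt-20387) and named print, i.e. Ko carries NO SURPLUS over BSD₃
# on the cell — INCLUDING its Manin slack `v₃ c(Dt)` (lead prover bsd-wall-soed-p2 g2; `--supports stmt-BirchSwinnertonDyer-20480`,
# helper; BSD is not proved by any of this)

WHY. The route's kernel uses Ko (co-STEP L at slack `v₃ c`) + E (STEP L at the same slack) to get the EXACT Heegner index and hence
`BSD₃(E) ⟺ BSD₃(E^{d_K})` (p528981, `bsdp_iff_partner_bsdp_of_exactIndexManin`). The refuter's junk audit (critic-2 g9) checked ON PAPER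
that the Manin slack is scale-consistent and that Ko is «the ≤ half of BSD₃(E/K) in Heegner-index currency». THIS FILE proves the converse
bookkeeping IN THE KERNEL: `BSD₃(E) ∧ BSD₃(E^{d_K})` give BOTH Miller halves at `E` and at a minimal model `Wd` of the twist, hence the JOINT
upper half over the pair, and the tree's exact Gross–Zagier identity `exists_shaAn_padicVal_eq_of_heegner_manin`
(`ord q + ord q_d + ord ∏c(E) + 2·ord #E^d(ℚ)_tors + 2·v_p(c) + ord u = 2·ord [E(K):ℤP]`, an EQUALITY) read BACKWARDS gives co-STEP L at
slack `v_p(c)` — the converse of door-c5's `Upper.jointUpperBoundAt_of_coStepL_manin`. Consequences: (i) Ko (with its `2·v₃ c` term) is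
implied by BSD, so no counterexample to Ko exists short of a counterexample to BSD₃ — the lead's MANIN-SHADOW memo §1(b) in the kernel;
(ii) modulo {E, V, C, NT, PUB} the crux Ko is EQUIVALENT to the leaf on the tower rows (the route's `closes` gives ⟸; this file gives ⟹
from the leaf and Z alone); (iii) the Manin slack is forced: a Manin-free Ko (slack `0`) would be STRICTLY WEAKER than what BSD gives and
would not meet the lower socket.

WHAT IS PROVED (no definition, no named fact, no `sorry`; CONDITIONAL on the displayed named facts {Gross–Zagier I.(6.3), Kolyvagin,
GZK, modularity, GZ86 I.(7.3)} and on the two conjectural leaves taken as hypotheses; nothing is asserted about any curve):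
* `indexUpperBoundLeAt_of_jointUpperBoundAt` — any odd `p ∣ N`, `r_an(E) = 1`, Heegner datum with odd `d_K`, `L(E^{d_K},1) ≠ 0`, `Wd` a
  globally minimal model of the twist: `Upper.JointUpperBoundAt W Wd p ⟹ Upper.IndexUpperBoundLeAt W p K P (v_p c(Dt))` (converse of
  `jointUpperBoundAt_of_coStepL_manin`; same proof, inequality reversed).
* `jointUpperBoundAt_of_bsdp_of_bsdp` — `BSDp W p ∧ BSDp Wd p ⟹ Upper.JointUpperBoundAt W Wd p` in analytic ranks `≤ 1` (Miller halves).
* **`wildKolyvaginUpperAtThree_of_wAllExclAddWildRankOneSurj_of_wAllExclAddWildRankZero`** — the crux Ko BY NAME from the leaf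
  `WAllExclAddWildRankOneSurj`, the residual `WAllExclAddWildRankZero` and the five named facts: Ko is NECESSARY for the route's target
  (given Z), not only sufficient (given E, V, C, NT, PUB).
References: [GrossZagier1986] Thm. I.(6.3), (7.3), V (2.2); [Gross1991] (2.3); [JetchevSkinnerWan2017] §7.4.1; [Miller2011LMS] Def. 1.1.
-/

set_option autoImplicit false
set_option linter.dupNamespace false -- `Summit.BirchSwinnertonDyer.BirchSwinnertonDyer.…` is the tree's layout (D-0017)

noncomputable section

open scoped Classical

namespace Summit.BirchSwinnertonDyer.BirchSwinnertonDyer.Theorems.WildKolyvaginUpperAtThreeTight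

open WeierstrassCurve NumberField IsDedekindDomain Field Literature.NumberTheory.EllipticCurves
  Literature.NumberTheory.EllipticCurves.ModularForms
  Literature.NumberTheory.EllipticCurves.Rank1Residual
  Literature.NumberTheory.EllipticCurves.Rank1Residual.Typed
  Summit.BirchSwinnertonDyer.Rank1Residual
  Summit.BirchSwinnertonDyer.Rank1Residual.Additive
  Summit.BirchSwinnertonDyer.Rank1Residual.X11b
  Summit.BirchSwinnertonDyer.BirchSwinnertonDyer.Theses.SemiOrdinaryEisensteinDescent
  Summit.BirchSwinnertonDyer.BirchSwinnertonDyer.Theorems.SchneiderFree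

/-! ## §1 JOINT upper half ⟹ co-STEP L at slack `v_p(c)` (converse of door-c5's bookkeeping) -/

/-- **JOINT upper ⟹ co-STEP L at slack `v_p(c)`, kernel-checked** — the CONVERSE of
`Upper.jointUpperBoundAt_of_coStepL_manin`: the tree's exact identity `exists_shaAn_padicVal_eq_of_heegner_manin` (an EQUALITY),
Gross–Zagier I.(7.3) for the twist's value, `#Ш_an(E^d) = q_d·#tors²/∏c(E^d)`, the two twist transports as EQUALITIES, and the
uniqueness of the rational `#Ш_an`. Facts by name as hypotheses. [cite: GrossZagier1986, Thm. I.(6.3) and (7.3)]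
[cite: JetchevSkinnerWan2017, §7.4.1 (arXiv:1512.06894 p. 30)] [cite: Miller2011LMS, Def. 1.1] -/
theorem indexUpperBoundLeAt_of_jointUpperBoundAt
    (hGZ : ∀ (N : ℕ) [NeZero N] (W : WeierstrassCurve ℚ) (K : Type) [Field K] [NumberField K],
      gross_zagier N W K)
    (hKo : ∀ (N : ℕ) [NeZero N] (W : WeierstrassCurve ℚ) (K : Type) [Field K] [NumberField K],
      kolyvagin N W K)
    (hGZK : rank_eq_analyticRank_of_analyticRank_le_one) (hmod : hasEntireLFunction_rat)
    (hGZ73 : GrossZagier1986_thm_I_7_3)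
    (W : WeierstrassCurve ℚ) [W.IsElliptic] [W.IsGloballyMinimal] (p : ℕ) [Fact p.Prime]
    (N : ℕ) [NeZero N] (K : Type) [Field K] [NumberField K]
    (Dt : ModularParametrizationData W N) (H : HeegnerDatum N (NumberField.discr K)) (ι : K →+* ℂ)
    (P : (W.baseChange K).toAffine.Point) (Wd : WeierstrassCurve ℚ) [Wd.IsElliptic] [Wd.IsGloballyMinimal]
    (hr : W.analyticRank = 1) (hN : W.conductorNorm ℤ = N) (hpN : p ∣ N) (hK : IsImaginaryQuadratic K)
    (hodd : Odd (NumberField.discr K)) (hw : ¬ p ∣ Units.torsionOrder K)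
    (hHH : SatisfiesHeegnerHypothesis N K)
    (hLd : (W.quadraticTwist (NumberField.discr K : ℚ)).entireLFunction 1 ≠ 0)
    (hP : WeierstrassCurve.Affine.Point.map ι.toRatAlgHom P = heegnerPointComplex Dt H)
    (hC : ∃ C : VariableChange ℚ, C • W.quadraticTwist (NumberField.discr K : ℚ) = Wd)
    (hp2 : p ≠ 2) (hJ : Upper.JointUpperBoundAt W Wd p) :
    Upper.IndexUpperBoundLeAt W p K P (padicValNat p Dt.c.natAbs) := by
  have hpp : p.Prime := Fact.out
  obtain ⟨Cd, hWd⟩ := hC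
  -- the twist's algebraic central value (Gross–Zagier I.(7.3))
  obtain ⟨qd, hqd⟩ := SchneiderFree.exists_rat_twist_L_one_div_realPeriod_of_heegner W N K Dt H ι P
    (hGZ N W K) (hKo N W K) hGZK hmod hGZ73 hK hHH hP hr hLd Wd Cd hWd
  -- the Manin-robust bookkeeping identity (an EQUALITY)
  obtain ⟨-, -, hsha, q, hq, hval⟩ := SchneiderFree.exists_shaAn_padicVal_eq_of_heegner_manin W p N K
    Dt H ι P (hGZ N W K) (hKo N W K) hGZK hmod hK hHH hP hp2 hw hr hLd Wd Cd hWd qd hqd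
  -- `#Ш_an(E^{d_K})` in rank zero
  have hD0 : (NumberField.discr K : ℚ) ≠ 0 := by exact_mod_cast NumberField.discr_ne_zero K
  haveI : (W.quadraticTwist (NumberField.discr K : ℚ)).IsElliptic := W.isElliptic_quadraticTwist hD0
  have hLd1 : Wd.entireLFunction 1 ≠ 0 := by rw [← hWd, entireLFunction_smul]; exact hLd
  obtain ⟨-, hfin, -, hshaAnd⟩ := Wuthrich2014.shaAn_eq_of_L_one_div_eq hGZK Wd hLd1 hqd
  haveI := hfin
  have htdeq : Wd.torsionOrder = Nat.card Wd.toAffine.Point := Wd.torsionOrder_eq_natCard_of_finite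
  -- the two transports, as EQUALITIES (`p` odd, `p ∣ N` split in `K`)
  have hHN' : SatisfiesHeegnerHypothesis (W.conductorNorm ℤ) K := by rw [hN]; exact hHH
  have hHp : SatisfiesHeegnerHypothesis p K := SatisfiesHeegnerHypothesis.of_dvd hpN hHH
  have hpd : ¬ (p : ℤ) ∣ NumberField.discr K :=
    X11b.Three.not_dvd_discr_of_ncard_primesOver_eq_two hK.1 hp2 (hHH p hpp hpN)
  have htam := X2.padicValNat_tamagawaProduct_twist_of_heegner_of_odd W p hp2 K hK hodd hpd hHN' Cd hWd
  have hu := AdditivePotMult.padicValRat_u_eq_zero_of_twist_minimal_of_split W p K hK hHp Cd hWd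
  -- the joint upper half, with its two rationals identified
  obtain ⟨q', qd', hq', hqd', hle⟩ := hJ
  have hqq : q' = q := by exact_mod_cast hq'.symm.trans hq
  have hqdqd : qd' = qd * (Nat.card Wd.toAffine.Point : ℚ) ^ 2 / (Wd.tamagawaProduct : ℚ) := by
    exact_mod_cast hqd'.symm.trans hshaAnd
  subst hqq hqdqd
  have hqd0 : qd ≠ 0 := by
    intro h0
    apply hLd1
    have hΩ : (Wd.realPeriodRat : ℂ) ≠ 0 := by exact_mod_cast Wd.realPeriodRat_pos_holds.ne'
    rw [h0, Rat.cast_zero, div_eq_zero_iff] at hqd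
    exact hqd.resolve_right hΩ
  have htd0 : (Nat.card Wd.toAffine.Point : ℚ) ≠ 0 := by exact_mod_cast (Nat.card_pos).ne'
  have hcd0 : (Wd.tamagawaProduct : ℚ) ≠ 0 := by exact_mod_cast Wd.tamagawaProduct_pos_holds.ne'
  have hvd : padicValRat p (qd * (Nat.card Wd.toAffine.Point : ℚ) ^ 2 / (Wd.tamagawaProduct : ℚ)) =
      padicValRat p qd + 2 * padicValNat p Wd.torsionOrder - padicValNat p Wd.tamagawaProduct := by
    rw [padicValRat.div (mul_ne_zero hqd0 (pow_ne_zero _ htd0)) hcd0, padicValRat.mul hqd0 (pow_ne_zero _ htd0),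
      padicValRat.pow, padicValRat.of_nat, padicValRat.of_nat, htdeq]
    push_cast; ring
  rw [hvd] at hle
  unfold Upper.IndexUpperBoundLeAt
  have e2 : (padicValNat p (W.baseChange K).shaOrder : ℤ) =
      padicValNat p W.shaOrder + padicValNat p Wd.shaOrder := by exact_mod_cast hsha
  have e3 : (padicValNat p Wd.tamagawaProduct : ℤ) = padicValNat p W.tamagawaProduct := by exact_mod_cast htam
  have e1 : (padicValNat p (W.baseChange K).shaOrder : ℤ) + 2 * padicValNat p W.tamagawaProduct +
      2 * padicValNat p Dt.c.natAbs ≤ 2 * padicValNat p (AddSubgroup.zmultiples P).index := by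
    linarith
  exact_mod_cast e1

/-! ## §2 `BSD_p(E) ∧ BSD_p(E^{d})` ⟹ the JOINT upper half -/

/-- **Both BSD_p's give the JOINT upper half** (analytic ranks `≤ 1`, so both `Ш` are finite by Gross–Zagier–Kolyvagin `hGZK` and
`BSDp` yields Miller's missing `p`-part, whose upper halves add). [cite: Miller2011LMS, Def. 1.1 (arXiv:1010.2431 p. 3)] -/
theorem jointUpperBoundAt_of_bsdp_of_bsdp (hGZK : rank_eq_analyticRank_of_analyticRank_le_one)
    (W Wd : WeierstrassCurve ℚ) [W.IsElliptic] [Wd.IsElliptic] (p : ℕ) [Fact p.Prime]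
    (hrW : W.analyticRank ≤ 1) (hrWd : Wd.analyticRank ≤ 1) (hW : BSDp W p) (hWd : BSDp Wd p) :
    Upper.JointUpperBoundAt W Wd p := by
  haveI : Finite W.sha := (hGZK W hrW).2
  haveI : Finite Wd.sha := (hGZK Wd hrWd).2
  obtain ⟨-, ⟨q, hq, hqle⟩⟩ := lower_and_upper_of_missingPPartAt W p (missingPPartAt_of_bsdp W p hW)
  obtain ⟨-, ⟨qd, hqd, hqdle⟩⟩ := lower_and_upper_of_missingPPartAt Wd p (missingPPartAt_of_bsdp Wd p hWd)
  exact ⟨q, qd, hq, hqd, by linarith⟩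

/-! ## §3 Ko from the leaf, the rank-zero residual and print: Ko is TIGHT -/

/-- **Crux Ko `WildKolyvaginUpperAtThree` BY NAME ⟸ the leaf `WAllExclAddWildRankOneSurj` + the residual `WAllExclAddWildRankZero`
(route item `WildRankZeroTwistAtThree`, stmt-20387) + {Gross–Zagier, Kolyvagin, GZK, modularity, GZ86 I.(7.3)}.** For every instance of
Ko's binders: `E` is non-CM (`ρ̄₃` onto), a globally minimal model `Wd` of `E^{d_K}` exists (`hasGlobalMinimalModel_rat_holds`) and is again a
non-CM `ClassO6` curve at `3` of analytic rank `0` (`classO6_twist_of_heegner`, `hasCM_iff_of_j_eq`); the leaf gives `BSD₃(E)`, the residual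
gives `BSD₃(Wd)`; §2 + §1 give the socket `Upper.IndexUpperBoundLeAt W 3 K P (v₃ c(Dt))`. So Ko — WITH its Manin slack — is implied by
BSD₃ on the two rows: it carries no surplus (the tower binder, `d_K ≠ −3`, `P` non-torsion are idle here). CONDITIONAL on the two
conjectural leaves and the five named facts (hypotheses). [cite: GrossZagier1986, Thm. I.(6.3), (7.3) and V (2.2)]
[cite: JetchevSkinnerWan2017, §7.4.1] [cite: Miller2011LMS, Def. 1.1] -/
theorem wildKolyvaginUpperAtThree_of_wAllExclAddWildRankOneSurj_of_wAllExclAddWildRankZero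
    (hGZ : ∀ (N : ℕ) [NeZero N] (W : WeierstrassCurve ℚ) (K : Type) [Field K] [NumberField K],
      gross_zagier N W K)
    (hKo : ∀ (N : ℕ) [NeZero N] (W : WeierstrassCurve ℚ) (K : Type) [Field K] [NumberField K],
      kolyvagin N W K)
    (hGZK : rank_eq_analyticRank_of_analyticRank_le_one) (hmod : hasEntireLFunction_rat)
    (hGZ73 : GrossZagier1986_thm_I_7_3)
    (hLeaf : Summit.BirchSwinnertonDyer.WAllExclAddWildRankOneSurj)
    (hZ : Summit.BirchSwinnertonDyer.WAllExclAddWildRankZero) :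
    WildKolyvaginUpperAtThree := by
  intro W _ _ N _ K _ _ Dt H ι P hO6 hsurj hr hN hK hHH hLd hP _hnt hodd _h3 _htower
  haveI : Fact (Nat.Prime 3) := ⟨Nat.prime_three⟩
  have h3N : 3 ∣ W.conductorNorm ℤ :=
    (W.dvd_conductorNorm_iff_not_hasGoodReductionAtPrime 3).mpr (not_good_of_addv W 3 hO6.2.1)
  have hpN : 3 ∣ N := hN ▸ h3N
  have hHN' : SatisfiesHeegnerHypothesis (W.conductorNorm ℤ) K := by rw [hN]; exact hHH
  have hw : ¬ 3 ∣ Units.torsionOrder K :=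
    (X11b.Three.not_dvd_discr_and_not_dvd_torsionOrder_of_heegner hK hHH (by decide) hpN).2
  -- `E` is non-CM (onto mod `3`), hence `BSD₃(E)` from the leaf
  have hCM : ¬ W.HasCM := fun hCM ↦
    W.not_hasSurjectiveModNGaloisRep_of_hasCM hCM Nat.prime_three (by decide) hsurj
  have hW : BSDp W 3 := hLeaf W hCM hO6 hsurj hr
  -- a globally minimal model of the twist: a non-CM O6 row of analytic rank `0`, hence `BSD₃` from the residual
  have hD0 : (NumberField.discr K : ℚ) ≠ 0 := by exact_mod_cast NumberField.discr_ne_zero K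
  haveI : (W.quadraticTwist (NumberField.discr K : ℚ)).IsElliptic := W.isElliptic_quadraticTwist hD0
  obtain ⟨Cd, hCd⟩ := hasGlobalMinimalModel_rat_holds (W.quadraticTwist (NumberField.discr K : ℚ))
  haveI : (Cd • W.quadraticTwist (NumberField.discr K : ℚ)).IsGloballyMinimal := hCd
  set Wd := Cd • W.quadraticTwist (NumberField.discr K : ℚ) with hWd_def
  obtain ⟨hO6d, hjd⟩ := classO6_twist_of_heegner W hO6 K hK hHN' hodd Wd Cd rfl
  have hCMd : ¬ Wd.HasCM := fun h ↦ hCM ((hasCM_iff_of_j_eq hjd).mp h)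
  have hLd1 : Wd.entireLFunction 1 ≠ 0 := by rw [hWd_def, entireLFunction_smul]; exact hLd
  have hrd : Wd.analyticRank = 0 := analyticRank_eq_zero_of_entireLFunction_one_ne_zero Wd hLd1
  have hWdB : BSDp Wd 3 := hZ Wd hCMd hO6d hrd
  -- joint upper half, then co-STEP L at slack `v₃ c`
  have hJ : Upper.JointUpperBoundAt W Wd 3 :=
    jointUpperBoundAt_of_bsdp_of_bsdp hGZK W Wd 3 (by rw [hr]) (by rw [hrd]; exact zero_le_one) hW hWdB
  exact indexUpperBoundLeAt_of_jointUpperBoundAt hGZ hKo hGZK hmod hGZ73 W 3 N K Dt H ι P Wd hr hN hpN hK hodd hw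
    hHH hLd hP ⟨Cd, rfl⟩ (by decide) hJ

/-! ## §4 (appended) The LOWER mirror and the pair: `BSD_p(E) ∧ BSD_p(E^d)` ⟹ BOTH sockets at slack `v_p(c)` -/

/-- **JOINT lower ⟹ STEP L at slack `v_p(c)`** — the CONVERSE of door-c5's CLOSED item 19180
`SchneiderFree.Exact.jointLowerBoundAt_of_stepL_manin` (same identity, inequality reversed). Facts by name as hypotheses.
[cite: GrossZagier1986, Thm. I.(6.3) and (7.3)] [cite: JetchevSkinnerWan2017, §7.4.1 (arXiv:1512.06894 p. 30)] [cite: Miller2011LMS, Def. 1.1] -/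
theorem indexLowerBoundLeAt_of_jointLowerBoundAt
    (hGZ : ∀ (N : ℕ) [NeZero N] (W : WeierstrassCurve ℚ) (K : Type) [Field K] [NumberField K],
      gross_zagier N W K)
    (hKo : ∀ (N : ℕ) [NeZero N] (W : WeierstrassCurve ℚ) (K : Type) [Field K] [NumberField K],
      kolyvagin N W K)
    (hGZK : rank_eq_analyticRank_of_analyticRank_le_one) (hmod : hasEntireLFunction_rat)
    (hGZ73 : GrossZagier1986_thm_I_7_3)
    (W : WeierstrassCurve ℚ) [W.IsElliptic] [W.IsGloballyMinimal] (p : ℕ) [Fact p.Prime]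
    (N : ℕ) [NeZero N] (K : Type) [Field K] [NumberField K]
    (Dt : ModularParametrizationData W N) (H : HeegnerDatum N (NumberField.discr K)) (ι : K →+* ℂ)
    (P : (W.baseChange K).toAffine.Point) (Wd : WeierstrassCurve ℚ) [Wd.IsElliptic] [Wd.IsGloballyMinimal]
    (hr : W.analyticRank = 1) (hN : W.conductorNorm ℤ = N) (hpN : p ∣ N) (hK : IsImaginaryQuadratic K)
    (hodd : Odd (NumberField.discr K)) (hw : ¬ p ∣ Units.torsionOrder K)
    (hHH : SatisfiesHeegnerHypothesis N K)
    (hLd : (W.quadraticTwist (NumberField.discr K : ℚ)).entireLFunction 1 ≠ 0)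
    (hP : WeierstrassCurve.Affine.Point.map ι.toRatAlgHom P = heegnerPointComplex Dt H)
    (hC : ∃ C : VariableChange ℚ, C • W.quadraticTwist (NumberField.discr K : ℚ) = Wd)
    (hp2 : p ≠ 2) (hJ : JointLowerBoundAt W Wd p) :
    IndexLowerBoundLeAt W p K P (padicValNat p Dt.c.natAbs) := by
  have hpp : p.Prime := Fact.out
  obtain ⟨Cd, hWd⟩ := hC
  obtain ⟨qd, hqd⟩ := SchneiderFree.exists_rat_twist_L_one_div_realPeriod_of_heegner W N K Dt H ι P
    (hGZ N W K) (hKo N W K) hGZK hmod hGZ73 hK hHH hP hr hLd Wd Cd hWd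
  obtain ⟨-, -, hsha, q, hq, hval⟩ := SchneiderFree.exists_shaAn_padicVal_eq_of_heegner_manin W p N K
    Dt H ι P (hGZ N W K) (hKo N W K) hGZK hmod hK hHH hP hp2 hw hr hLd Wd Cd hWd qd hqd
  have hD0 : (NumberField.discr K : ℚ) ≠ 0 := by exact_mod_cast NumberField.discr_ne_zero K
  haveI : (W.quadraticTwist (NumberField.discr K : ℚ)).IsElliptic := W.isElliptic_quadraticTwist hD0
  have hLd1 : Wd.entireLFunction 1 ≠ 0 := by rw [← hWd, entireLFunction_smul]; exact hLd
  obtain ⟨-, hfin, -, hshaAnd⟩ := Wuthrich2014.shaAn_eq_of_L_one_div_eq hGZK Wd hLd1 hqd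
  haveI := hfin
  have htdeq : Wd.torsionOrder = Nat.card Wd.toAffine.Point := Wd.torsionOrder_eq_natCard_of_finite
  have hHN' : SatisfiesHeegnerHypothesis (W.conductorNorm ℤ) K := by rw [hN]; exact hHH
  have hHp : SatisfiesHeegnerHypothesis p K := SatisfiesHeegnerHypothesis.of_dvd hpN hHH
  have hpd : ¬ (p : ℤ) ∣ NumberField.discr K :=
    X11b.Three.not_dvd_discr_of_ncard_primesOver_eq_two hK.1 hp2 (hHH p hpp hpN)
  have htam := X2.padicValNat_tamagawaProduct_twist_of_heegner_of_odd W p hp2 K hK hodd hpd hHN' Cd hWd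
  have hu := AdditivePotMult.padicValRat_u_eq_zero_of_twist_minimal_of_split W p K hK hHp Cd hWd
  obtain ⟨q', qd', hq', hqd', hle⟩ := hJ
  have hqq : q' = q := by exact_mod_cast hq'.symm.trans hq
  have hqdqd : qd' = qd * (Nat.card Wd.toAffine.Point : ℚ) ^ 2 / (Wd.tamagawaProduct : ℚ) := by
    exact_mod_cast hqd'.symm.trans hshaAnd
  subst hqq hqdqd
  have hqd0 : qd ≠ 0 := by
    intro h0
    apply hLd1
    have hΩ : (Wd.realPeriodRat : ℂ) ≠ 0 := by exact_mod_cast Wd.realPeriodRat_pos_holds.ne'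
    rw [h0, Rat.cast_zero, div_eq_zero_iff] at hqd
    exact hqd.resolve_right hΩ
  have htd0 : (Nat.card Wd.toAffine.Point : ℚ) ≠ 0 := by exact_mod_cast (Nat.card_pos).ne'
  have hcd0 : (Wd.tamagawaProduct : ℚ) ≠ 0 := by exact_mod_cast Wd.tamagawaProduct_pos_holds.ne'
  have hvd : padicValRat p (qd * (Nat.card Wd.toAffine.Point : ℚ) ^ 2 / (Wd.tamagawaProduct : ℚ)) =
      padicValRat p qd + 2 * padicValNat p Wd.torsionOrder - padicValNat p Wd.tamagawaProduct := by
    rw [padicValRat.div (mul_ne_zero hqd0 (pow_ne_zero _ htd0)) hcd0, padicValRat.mul hqd0 (pow_ne_zero _ htd0),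
      padicValRat.pow, padicValRat.of_nat, padicValRat.of_nat, htdeq]
    push_cast; ring
  rw [hvd] at hle
  unfold IndexLowerBoundLeAt
  have e2 : (padicValNat p (W.baseChange K).shaOrder : ℤ) =
      padicValNat p W.shaOrder + padicValNat p Wd.shaOrder := by exact_mod_cast hsha
  have e3 : (padicValNat p Wd.tamagawaProduct : ℤ) = padicValNat p W.tamagawaProduct := by exact_mod_cast htam
  have e1 : 2 * (padicValNat p (AddSubgroup.zmultiples P).index : ℤ) ≤
      (padicValNat p (W.baseChange K).shaOrder : ℤ) + 2 * padicValNat p W.tamagawaProduct +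
      2 * padicValNat p Dt.c.natAbs := by
    linarith
  exact_mod_cast e1

/-- **Both BSD_p's give the JOINT lower half** (mirror of `jointUpperBoundAt_of_bsdp_of_bsdp`). [cite: Miller2011LMS, Def. 1.1] -/
theorem jointLowerBoundAt_of_bsdp_of_bsdp (hGZK : rank_eq_analyticRank_of_analyticRank_le_one)
    (W Wd : WeierstrassCurve ℚ) [W.IsElliptic] [Wd.IsElliptic] (p : ℕ) [Fact p.Prime]
    (hrW : W.analyticRank ≤ 1) (hrWd : Wd.analyticRank ≤ 1) (hW : BSDp W p) (hWd : BSDp Wd p) :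
    JointLowerBoundAt W Wd p := by
  haveI : Finite W.sha := (hGZK W hrW).2
  haveI : Finite Wd.sha := (hGZK Wd hrWd).2
  obtain ⟨⟨q, hq, hqle⟩, -⟩ := lower_and_upper_of_missingPPartAt W p (missingPPartAt_of_bsdp W p hW)
  obtain ⟨⟨qd, hqd, hqdle⟩, -⟩ := lower_and_upper_of_missingPPartAt Wd p (missingPPartAt_of_bsdp Wd p hWd)
  exact ⟨q, qd, hq, hqd, by linarith⟩

/-- **`BSD_p(E) ∧ BSD_p(E^{d_K})` ⟹ the EXACT Heegner index at slack `v_p(c(Dt))`: BOTH sockets** (STEP L and co-STEP L) — the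
converse of the kernel's descent (p528981 / `bsdp_iff_partner_bsdp_of_exactIndexManin`): on every Heegner datum of the cells the pair
{route SOED's E-side consequence `IndexLowerBoundLeAt`, its Ko-side consequence `Upper.IndexUpperBoundLeAt`} is IMPLIED by BSD_p of the two
rows. Together with p528981: (both sockets) ⟹ (BSD_p(E) ⟺ BSD_p(E^d)), and (BSD_p(E) ∧ BSD_p(E^d)) ⟹ (both sockets); one equation for two
unknowns, as it must be. Any odd `p ∣ N`. [cite: GrossZagier1986, Thm. I.(6.3), (7.3) and V (2.2)] [cite: Miller2011LMS, Def. 1.1] -/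
theorem indexBounds_of_bsdp_of_partner_bsdp
    (hGZ : ∀ (N : ℕ) [NeZero N] (W : WeierstrassCurve ℚ) (K : Type) [Field K] [NumberField K],
      gross_zagier N W K)
    (hKo : ∀ (N : ℕ) [NeZero N] (W : WeierstrassCurve ℚ) (K : Type) [Field K] [NumberField K],
      kolyvagin N W K)
    (hGZK : rank_eq_analyticRank_of_analyticRank_le_one) (hmod : hasEntireLFunction_rat)
    (hGZ73 : GrossZagier1986_thm_I_7_3)
    (W : WeierstrassCurve ℚ) [W.IsElliptic] [W.IsGloballyMinimal] (p : ℕ) [Fact p.Prime]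
    (N : ℕ) [NeZero N] (K : Type) [Field K] [NumberField K]
    (Dt : ModularParametrizationData W N) (H : HeegnerDatum N (NumberField.discr K)) (ι : K →+* ℂ)
    (P : (W.baseChange K).toAffine.Point) (Wd : WeierstrassCurve ℚ) [Wd.IsElliptic] [Wd.IsGloballyMinimal]
    (hr : W.analyticRank = 1) (hN : W.conductorNorm ℤ = N) (hpN : p ∣ N) (hK : IsImaginaryQuadratic K)
    (hodd : Odd (NumberField.discr K)) (hw : ¬ p ∣ Units.torsionOrder K)
    (hHH : SatisfiesHeegnerHypothesis N K)
    (hLd : (W.quadraticTwist (NumberField.discr K : ℚ)).entireLFunction 1 ≠ 0)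
    (hP : WeierstrassCurve.Affine.Point.map ι.toRatAlgHom P = heegnerPointComplex Dt H)
    (hC : ∃ C : VariableChange ℚ, C • W.quadraticTwist (NumberField.discr K : ℚ) = Wd)
    (hp2 : p ≠ 2) (hWB : BSDp W p) (hWdB : BSDp Wd p) :
    IndexLowerBoundLeAt W p K P (padicValNat p Dt.c.natAbs) ∧
      Upper.IndexUpperBoundLeAt W p K P (padicValNat p Dt.c.natAbs) := by
  obtain ⟨Cd, hWd⟩ := hC
  have hD0 : (NumberField.discr K : ℚ) ≠ 0 := by exact_mod_cast NumberField.discr_ne_zero K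
  haveI : (W.quadraticTwist (NumberField.discr K : ℚ)).IsElliptic := W.isElliptic_quadraticTwist hD0
  have hLd1 : Wd.entireLFunction 1 ≠ 0 := by rw [← hWd, entireLFunction_smul]; exact hLd
  have hrd : Wd.analyticRank = 0 := analyticRank_eq_zero_of_entireLFunction_one_ne_zero Wd hLd1
  have hrW : W.analyticRank ≤ 1 := by rw [hr]
  have hrWd : Wd.analyticRank ≤ 1 := by rw [hrd]; exact zero_le_one
  exact ⟨indexLowerBoundLeAt_of_jointLowerBoundAt hGZ hKo hGZK hmod hGZ73 W p N K Dt H ι P Wd hr hN hpN hK hodd hw hHH hLd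
      hP ⟨Cd, hWd⟩ hp2 (jointLowerBoundAt_of_bsdp_of_bsdp hGZK W Wd p hrW hrWd hWB hWdB),
    indexUpperBoundLeAt_of_jointUpperBoundAt hGZ hKo hGZK hmod hGZ73 W p N K Dt H ι P Wd hr hN hpN hK hodd hw hHH hLd
      hP ⟨Cd, hWd⟩ hp2 (jointUpperBoundAt_of_bsdp_of_bsdp hGZK W Wd p hrW hrWd hWB hWdB)⟩

end Summit.BirchSwinnertonDyer.BirchSwinnertonDyer.Theorems.WildKolyvaginUpperAtThreeTight

end
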